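import Summits.Schanuel.Schanuel.Theses.RigidCore
import Summits.Schanuel.Schanuel.Theorems.AclSubsetLogFreeCore.Negative.LogFreeCoreObjects
import Literature.NumberTheory.Transcendental.ZilberThm15
import Literature.NumberTheory.Transcendental.ZilberFieldQuasiminimal
import Literature.NumberTheory.Transcendental.ZilberProp112Twisted
import HarnessLib.Audit

/-!
# Line `eac-homogeneity-collapse` — skeleton for crux `RigidCore.AclSubsetLogFreeCore`
(item stmt-Schanuel-0968, route route-Schanuel-RigidCore; the merged EAC line of the round-1 panel:
cards `eac-homogeneity-collapse` ≈ `eac-extends-core-automorphisms` ≈ `eac-prime-model-over-core`)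

Crux (A): `acl^{ℂ_exp}(∅) ⊆ C_EA` — every element of a FINITE `∅`-definable subset of
`(ℂ, +, ·, −, 0, 1, exp)` lies in the log-free core `C_EA = logFreeCore`
(`Negative.aclSubsetLogFreeCore_iff : (A) ↔ expAcl ⊆ logFreeCore`, `Iff.rfl`).

Idea (one lever, Bays–Kirby 2018 Thm 11.6 run over the countable Γ-closed base `K = ecl ∅`, which the
tree PROVES for `ℂ` as `isQuasiminimal_of_isExpAlgClosed_holds` together with its twisted-Γ-isomorphism
machinery): under exponential-algebraic closedness of `ℂ_exp` (Zilber's EAC, `stub_eac`, OPEN) the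
back-and-forth system of Γ-isomorphisms over `K` collapses `∅`-definability onto the countable core
`C₀ := ecl(∅)` in two ways —
* `stub_definableDichotomy` (provable now, M): a parameter-free definable set is contained in `ecl ∅` or
  contains its complement (the step `hgen` of `GammaField.isQuasiminimal_of_ccp_of_extension` at `b = ∅`);
  with CCP, finite definable sets are inside `C₀` (`expAcl_subset_ecl`, glue);
* `stub_coreAutElementary` (provable now, L): every exponential-field automorphism `θ` of the countable
  E-field `C₀` preserves the trace on `C₀` of every `∅`-definable set (Karp over the TWISTED system of
  Γ-isomorphisms over the base isomorphism `σ = θ`: `IsGammaIsoTw`, `isGammaIsoTw_saturation`,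
  `isGenericallyStronglyGammaClosedOver_complex_of_isExpAlgClosed`, `realize_iff_of_isBackAndForth`);
so that a finite `∅`-definable set containing `a` contains the whole `Aut_E(C₀)`-orbit of `a`, which is
therefore finite (`orbit_finite`, glue); the elementary symmetric functions of that orbit are FIXED by
`Aut_E(C₀)` (`Aut_E(C₀)` permutes the orbit), and the residual stub
* `stub_coreFixedLogFree` (OPEN — the arithmetic residue (A₀) in its weakest sufficient form): an element
  of `C₀` fixed by every E-automorphism of `C₀` is log-free,
puts them in `C_EA`; `C_EA` is relatively algebraically closed, so `a ∈ C_EA`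
(`mem_logFreeCore_of_orbit_finite`, glue). `AclSubsetLogFreeCore_of` concludes the crux BY NAME.

Status of the line: CONDITIONAL — it closes (A) relative to `stub_eac` (Zilber's EAC conjecture; no
transcendence content: it holds in the Bays–Kirby fields `𝔹_P`) and `stub_coreFixedLogFree` (a statement
about ONE countable exponential field and its automorphism group; ≥ "relation ⇒ log-free" instances of
Schanuel over the core, e.g. it yields `ln 2 ∈ C_EA ∨ (π, ln 2 algebraically independent)` by the
argument of support item `EndomorphismMovingLogTwo` run inside `C₀`). The two middle stubs are theorems of
the tree's Γ-field algebra waiting to be assembled.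

Disproof.lean obligations honoured (cdisprove gen 2, `Cruxes/AclSubsetLogFreeCore/Disproof.lean`; landed
`Theorems/AclSubsetLogFreeCore/Negative/{LogFreeCoreObjects (imported), ExpAclDefinability, LogFreeCoreCountable}`):
`aclSubsetLogFreeCore_false_without_finite` — finiteness is consumed in `orbit_finite` / `expAcl_subset_ecl`
(a finite set cannot contain the co-countable `ℂ ∖ ecl ∅`); `aclSubsetLogFreeCore_false_with_params_univ/
_real/_with_one_real_param` — parameter-freeness is consumed in `stub_coreAutElementary` (θ moves every
non-∅-definable parameter; elementarity is claimed for `∅`-definable sets only) and in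
`stub_definableDichotomy` (base `b = ∅`); `aclSubsetLogFreeCore_false_without_expClosed` (Nesterenko, `e^π`)
and `_false_without_period_and_exp` (`e`) — the `exp`-closure of `C_EA` and `2πi ∈ C_EA` are used (only)
inside `stub_coreFixedLogFree`, whose instances `e, e^π, π ∈ dcl(∅)` are fixed by all of `Aut_E(C₀)`;
§7 `not_branchIndiscernibility` (Kummer parity of the branches of `log 2` is `∅`-definable) — respected:
by `stub_coreAutElementary` every θ moves `ln 2` inside `ln 2 + 4πiℤ`, and `stub_coreFixedLogFree` asks for
ONE automorphism moving a non-core element, never for transitivity on a fibre of `exp`; §5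
`conj_mem_of_definable₁` is the instance `θ = conj|_{C₀}` of `stub_coreAutElementary`.
No stub is an instance of a landed Negative lemma or of a `ledger negatives` entry (2 PolarPhantoms items).

`lean check`: sorries ONLY in `stub_eac`, `stub_definableDichotomy`, `stub_coreAutElementary`,
`stub_coreFixedLogFree`; everything under `## Glue` is sorry-free.
-/

noncomputable section

set_option linter.dupNamespace false

open Set FirstOrder FirstOrder.Language
open Literature.ModelTheory.ExponentialFields Literature.NumberTheory.Transcendental
open Summit.Schanuel.Schanuel.Theorems.AclSubsetLogFreeCore.Negative

namespace Summit.Schanuel.Schanuel.Cruxes.AclSubsetLogFreeCore.EacHomogeneityCollapse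

/-! ## Stubs (the registered open lemmas of the line) -/

/-- **Stub 0 — Zilber's exponential-algebraic closedness of `ℂ_exp` (EAC; OPEN CONJECTURE).** Every
irreducible rotund, additively and multiplicatively free subvariety of `ℂⁿ × (ℂˣ)ⁿ` of dimension `n` meets
the graph of `exp` (Zilber 2005 §1 axiom (EC); Bays–Kirby 2018 Conj. 1.3 minus Schanuel). Known: `n = 1`
(Marker 2006), dominant additive projection (Brownawell–Masser 2017 Prop. 2 = Aslanyan–Kirby–Mantova 2023
Thm 1.5), `V = L × W` (Gallinaro 2023 Thm 8.8), all subvarieties of `ℂ² × (ℂˣ)²` (Mantova–Masser 2024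
Thm 1.1/1.2); open in general (Aslanyan–Gallinaro 2024 §3.4). It has NO transcendence content (it holds in
the Bays–Kirby fields `𝔹_P` violating Schanuel; barrier `AxiomsDoNotForceSchanuel`), which is why the line
needs Stub 3 as well. The line is CONDITIONAL on this stub; it is the hypothesis `hEAC` of Stubs 1–2. -/
theorem stub_eac : IsExpAlgClosed ℂ := by
  sorry

/-- **Stub 1 — the parameter-free dichotomy (Bays–Kirby 2018, Thm 11.6 / Cor. 11.7 at `b = ∅`; provable
now, size M).** Under EAC, a subset of `ℂ` definable WITHOUT parameters in `(ℂ, +, ·, −, 0, 1, exp)` is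
contained in the countable core `ecl ∅` or contains `ℂ ∖ ecl ∅`.
Plan: this is literally the step `hgen` ("all points outside `H` behave alike") of
`GammaField.isQuasiminimal_of_ccp_of_extension` (ZilberFieldQuasiminimalProps) with `b` the empty tuple,
`H = K = span ℚ (ecl ∅)`: for `a, a' ∉ ecl ∅` the state `(D₀, a) ↦ (D₀, a')` of the back-and-forth system
`isBackAndForth_gammaIso_of_extension` gives `a ∈ s ↔ a' ∈ s` by Karp (`realize_iff_of_isBackAndForth`);
the one-point extension property `hext` is discharged exactly as in `isQuasiminimal_of_ccp_of_saturatedOver`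
+ `isQuasiminimal_of_isExpAlgClosed_holds` (CCP `hasCountableClosureProperty_complex_holds`, Γ-closedness
`isGammaClosed_span_ecl_of_countable`, hull dichotomy `IsGammaIso.exists_extension_of_ccp`, saturation
`BaysKirby2018_prop_11_2_holds` over `isGenericallyStronglyGammaClosedOver_complex_of_isExpAlgClosed hEAC`).
Re-export the dichotomy instead of its corollary `IsQuasiminimal` (~150 lines, mostly the existing proof). -/
theorem stub_definableDichotomy (hEAC : IsExpAlgClosed ℂ) {s : Set ℂ}
    (hs : Set.Definable₁ (∅ : Set ℂ) Language.expRing s) :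
    s ⊆ ecl (∅ : Set ℂ) ∨ sᶜ ⊆ ecl (∅ : Set ℂ) := by
  sorry

/-- **Stub 2 — E-automorphisms of the countable core are elementary for `∅`-definable sets (EAC-homogeneity
run over a TWISTED base point; provable now, size L).** Under EAC, for every exponential-field automorphism
`θ` of `C₀ = ecl ∅` (an E-subfield: `Khovanskii.eclSubfield.instExponentialRing`) and every `∅`-definable
`s ⊆ ℂ`: `x ∈ s ↔ θ x ∈ s` for `x ∈ C₀`.
Plan (Karp over the twisted system; all ingredients proved in the tree): with `K = span ℚ (ecl ∅)`
(Γ-closed and countable by CCP) and `σ : fieldOf K ≃+* fieldOf K` the ring isomorphism induced by `θ`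
(`IsEBaseIso K K σ`: `θ` maps `K` onto `K` and commutes with `exp`), the states
"`c ↦ c'` is a Γ-isomorphism over `σ` (`GammaField.IsGammaIsoTw σ c c'`) with `K + ℚc ◁ ℂ`, `K + ℚc' ◁ ℂ`"
form an `L_exp`-back-and-forth system (twisted copy of `isBackAndForth_gammaIso_of_extension`: atomic
formulas via the glued field isomorphism `IsGammaIsoTw.fieldEquiv` / `fieldEquiv_exp`, term realisation as
in `exists_state_realize_term_of_extension`; forth/back by the twisted one-point extension = hull dichotomy
(twisted `IsGammaIso.exists_extension_of_ccp`, generic point by the twisted `snoc`) + twisted Prop. 11.2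
`GammaField.isGammaIsoTw_saturation` over `isGenericallyStronglyGammaClosedOver_complex_of_isExpAlgClosed
hEAC`, `Complex.isAlgClosed`, `isSurjectiveOntoUnits_complex`). The start state is `![x] ↦ ![θ x]`
(`x ∈ K`, `K ◁ ℂ`), so Karp (`realize_iff_of_isBackAndForth`) applied to the `∅`-formula defining `s`
(`Set.empty_definable_iff`) gives the claim. Template: `KMO2012.exists_equiv_extend_eclEmpty₀` (Zilber
fields). NOT claimed: a global extension `θ ⊆ ρ ∈ Aut(ℂ_exp)` (would need `ℂ ∈ 𝒦(M_tr(K))`, BK §6–7). -/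
theorem stub_coreAutElementary (hEAC : IsExpAlgClosed ℂ)
    (θ : ExponentialRingEquiv (Khovanskii.eclSubfield (∅ : Set ℂ)) (Khovanskii.eclSubfield (∅ : Set ℂ)))
    {s : Set ℂ} (hs : Set.Definable₁ (∅ : Set ℂ) Language.expRing s)
    (x : Khovanskii.eclSubfield (∅ : Set ℂ)) :
    (x : ℂ) ∈ s ↔ ((θ x : Khovanskii.eclSubfield (∅ : Set ℂ)) : ℂ) ∈ s := by
  sorry

/-- **Stub 3 — the residue (A₀), weakest sufficient form: `Fix(Aut_E(C₀)) ⊆ C_EA` (OPEN; the hardest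
stub; formula-free, about ONE countable exponential field).** An exponentially-algebraic number fixed by
every exponential-field automorphism of the countable core `C₀ = ecl ∅` lies in the log-free core
`C_EA = logFreeCore` (= `K_ω`, `Negative.logFreeCore_eq_Komega`).
Equivalent (pure algebra, see `mem_logFreeCore_of_orbit_finite` below) to the finite-orbit form
"`a ∈ C₀` with finite `Aut_E(C₀)`-orbit ⇒ `a ∈ C_EA`" (= `CoreOrbitsInfinite` of card
eac-extends-core-automorphisms); implied by Zilber's conjecture `ℂ_exp ≅ 𝔹` (homogeneity of `𝔹` over
strong finitely generated substructures; every `a ∈ C₀ ∖ C_EA` has a proper strong locus over `C_EA` with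
infinitely many generic realisations). Why it might fail / what it costs: any proof proves "accidental
relation ⇒ log-free" statements (IdeatorK3Notes BN1, findings F3): e.g. with `EndomorphismMovingLogTwo`'s
argument run inside `C₀` it gives `ln 2 ∈ C_EA ∨ AlgebraicIndependent ℚ ![π, ln 2]`; an element of
`ecl ∅ ∖ C_EA` with provably trivial `Aut_E(C₀)`-stabiliser failure is not available today (membership in
`C_EA` is undecided for every candidate), so the stub is irrefutable for the same reason (A) is. Honours
`aclSubsetLogFreeCore_false_without_expClosed` / `_without_period_and_exp`: `e, e^π, π ∈ dcl(∅)` are fixed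
by all of `Aut_E(C₀)` (Stub 2), so any proof must use that `C_EA` is `exp`-closed and contains `2πi`.
Instance engines available now: rank-one `∃`-witnesses (card points-not-automorphisms, Hadamard two
frequencies), Kummer-compatible shifts `ln p ↦ ln p + 2πik_p` (`4 ∣ k_2`, Disproof §7). -/
theorem stub_coreFixedLogFree (a : Khovanskii.eclSubfield (∅ : Set ℂ))
    (hfix : ∀ θ : ExponentialRingEquiv (Khovanskii.eclSubfield (∅ : Set ℂ))
      (Khovanskii.eclSubfield (∅ : Set ℂ)), θ a = a) :
    (a : ℂ) ∈ logFreeCore := by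
  sorry

/-! ## Glue (sorry-free) -/

/-- The countable core `C₀ = ecl ∅` as an E-subfield of `ℂ` (notation local to the glue). -/
local notation "C₀" => Khovanskii.eclSubfield (∅ : Set ℂ)

/-- `acl^{ℂ_exp}(∅) ⊆ ecl(∅)` under EAC: a FINITE `∅`-definable set cannot contain the co-countable
`ℂ ∖ ecl ∅` (`ecl ∅` is countable by the countable closure property, `ℂ` is not), so by Stub 1 it lies
inside `ecl ∅`. (Finiteness is load-bearing: `Negative.aclSubsetLogFreeCore_false_without_finite`.) -/
theorem expAcl_subset_ecl (hEAC : IsExpAlgClosed ℂ) : expAcl ⊆ ecl (∅ : Set ℂ) := by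
  rintro a ⟨s, hs, hdef, ha⟩
  rcases stub_definableDichotomy hEAC hdef with h | h
  · exact h ha
  · exfalso
    have hc : (ecl (∅ : Set ℂ)).Countable :=
      hasCountableClosureProperty_complex_holds _ Set.countable_empty
    refine not_countable_complex ?_
    rw [← Set.union_compl_self s]
    exact hs.countable.union (hc.mono h)

/-- Under EAC the `Aut_E(C₀)`-orbit of a point of a finite `∅`-definable set stays inside that set
(Stub 2), hence is finite. -/
theorem orbit_finite (hEAC : IsExpAlgClosed ℂ) {s : Set ℂ} (hs : s.Finite)
    (hdef : Set.Definable₁ (∅ : Set ℂ) Language.expRing s) (a : C₀) (ha : (a : ℂ) ∈ s) :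
    Set.Finite {b : C₀ | ∃ θ : ExponentialRingEquiv C₀ C₀, θ a = b} := by
  have hsub : ((↑) : C₀ → ℂ) '' {b : C₀ | ∃ θ : ExponentialRingEquiv C₀ C₀, θ a = b} ⊆ s := by
    rintro _ ⟨b, ⟨θ, rfl⟩, rfl⟩
    exact (stub_coreAutElementary hEAC θ hdef a).1 ha
  exact (hs.subset hsub).of_finite_image Subtype.coe_injective.injOn

/-- **From fixed points to finite orbits** (pure algebra over Stub 3): an element of `C₀` with finite
`Aut_E(C₀)`-orbit is log-free. `Aut_E(C₀)` permutes the orbit, so the monic polynomial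
`∏_{b ∈ orbit} (X − b) ∈ C₀[X]` has coefficients FIXED by every automorphism; by Stub 3 they lie in
`C_EA`, and `C_EA` is relatively algebraically closed in `ℂ` (`Negative.logFreeCore_mem_coreFamily`). -/
theorem mem_logFreeCore_of_orbit_finite (a : C₀)
    (hfin : Set.Finite {b : C₀ | ∃ θ : ExponentialRingEquiv C₀ C₀, θ a = b}) :
    (a : ℂ) ∈ logFreeCore := by
  classical
  set T : Finset C₀ := hfin.toFinset with hT
  have hmemT : ∀ {b : C₀}, b ∈ T ↔ ∃ θ : ExponentialRingEquiv C₀ C₀, θ a = b := fun {b} => by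
    rw [hT, Set.Finite.mem_toFinset]; rfl
  have haT : a ∈ T := hmemT.2 ⟨ExponentialRingEquiv.refl _, rfl⟩
  -- every automorphism permutes the orbit
  have himage : ∀ θ : ExponentialRingEquiv C₀ C₀, T.image θ = T := by
    intro θ
    ext b
    simp only [Finset.mem_image]
    constructor
    · rintro ⟨c, hc, rfl⟩
      obtain ⟨θ', rfl⟩ := hmemT.1 hc
      exact hmemT.2 ⟨θ'.trans θ, rfl⟩
    · intro hb
      obtain ⟨θ', rfl⟩ := hmemT.1 hb
      refine ⟨(θ'.trans θ.symm) a, hmemT.2 ⟨θ'.trans θ.symm, rfl⟩, ?_⟩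
      simp
  -- the orbit polynomial and its invariance
  set p : Polynomial C₀ := ∏ b ∈ T, (Polynomial.X - Polynomial.C b) with hp
  have hmonic : p.Monic :=
    Polynomial.monic_prod_of_monic _ _ fun b _ => Polynomial.monic_X_sub_C b
  have hmap : ∀ θ : ExponentialRingEquiv C₀ C₀, p.map (θ.toRingEquiv : C₀ →+* C₀) = p := by
    intro θ
    have hinj : ∀ x ∈ T, ∀ y ∈ T, θ x = θ y → x = y := fun x _ y _ h => EquivLike.injective θ h
    rw [hp, Polynomial.map_prod]
    simp only [Polynomial.map_sub, Polynomial.map_X, Polynomial.map_C]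
    have h1 : ∏ x ∈ T, (Polynomial.X - Polynomial.C ((θ.toRingEquiv : C₀ →+* C₀) x)) =
        ∏ x ∈ T, (Polynomial.X - Polynomial.C (θ x)) := rfl
    rw [h1, ← Finset.prod_image (s := T) (g := fun x => θ x)
      (f := fun b => Polynomial.X - Polynomial.C b) hinj, himage θ]
  have hcoeffFix : ∀ (n : ℕ) (θ : ExponentialRingEquiv C₀ C₀), θ (p.coeff n) = p.coeff n := by
    intro n θ
    have h := congrArg (fun q : Polynomial C₀ => q.coeff n) (hmap θ)
    simp only [Polynomial.coeff_map] at h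
    exact h
  -- the coefficients are log-free by Stub 3
  have hcoeff : ∀ n : ℕ, ((p.coeff n : C₀) : ℂ) ∈ logFreeCore := fun n =>
    stub_coreFixedLogFree (p.coeff n) (hcoeffFix n)
  -- `a` is a root of the orbit polynomial, read in `ℂ`
  have hpa : p.eval a = 0 := by
    rw [hp, Polynomial.eval_prod]
    exact Finset.prod_eq_zero haT (by simp)
  set q : Polynomial ℂ := p.map (Khovanskii.eclSubfield (∅ : Set ℂ)).subtype with hq
  have hqmonic : q.Monic := hmonic.map _
  have hqa : q.eval (a : ℂ) = 0 := by
    change Polynomial.eval ((Khovanskii.eclSubfield (∅ : Set ℂ)).subtype a) q = 0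
    rw [hq, Polynomial.eval_map, Polynomial.eval₂_hom, hpa, map_zero]
  have hqcoeff : ∀ j, q.coeff j ∈ logFreeCore := fun j => by
    rw [hq, Polynomial.coeff_map]
    exact hcoeff j
  have hlift : q ∈ Polynomial.lifts (algebraMap logFreeCore ℂ) := by
    rw [Polynomial.lifts_iff_coeff_lifts]
    intro j
    exact ⟨⟨_, hqcoeff j⟩, rfl⟩
  obtain ⟨r, hrmap, -, hrmonic⟩ := Polynomial.lifts_and_degree_eq_and_monic hlift hqmonic
  have hra : Polynomial.aeval (a : ℂ) r = 0 := by
    rw [Polynomial.aeval_def, ← Polynomial.eval_map, hrmap]; exact hqa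
  exact logFreeCore_mem_coreFamily.2.2 (a : ℂ) ⟨r, hrmonic.ne_zero, hra⟩

/-- **The composition (concludes the crux BY NAME).** EAC (Stub 0) + the dichotomy (Stub 1) put a point
`a` of a finite `∅`-definable set `s` into `C₀ = ecl ∅`; by elementarity (Stub 2) its `Aut_E(C₀)`-orbit
stays in `s`, hence is finite; by the residue (Stub 3, via symmetric functions) `a ∈ C_EA`. -/
theorem AclSubsetLogFreeCore_of : Summit.Schanuel.Schanuel.Theses.RigidCore.AclSubsetLogFreeCore := by
  rw [aclSubsetLogFreeCore_iff]
  rintro a ⟨s, hs, hdef, ha⟩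
  have haE : a ∈ ecl (∅ : Set ℂ) := expAcl_subset_ecl stub_eac ⟨s, hs, hdef, ha⟩
  exact mem_logFreeCore_of_orbit_finite ⟨a, haE⟩ (orbit_finite stub_eac hs hdef ⟨a, haE⟩ ha)

end Summit.Schanuel.Schanuel.Cruxes.AclSubsetLogFreeCore.EacHomogeneityCollapse
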